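import Summits.BirchSwinnertonDyer.Rank1Residual.X9.TransportSweepA
import HarnessLib

/-!
# Class X9, `p = 5`: the one flagged-only X9 pair of conductor `< 5000` — `BSD(4418c1, 5)` is Miller 2011 Thm. 1.2 verbatim (per-pair kernel record)

HONEST FRAMING (cell `b2b-bsdres-*`, verbatim): the cell deletes COMBINATION-SHAPED residual classes of
the rank-≤1 BSD formula from PUBLISHED theorems only and TYPES the construction-shaped remainder; this
is not "finishing BSD". Class X9 (good ordinary `p ≥ 5`, `ρ̄_{E,p}` irreducible and not surjective) stays
TYPED at class level; everything here is PER PAIR; no lane verdict is changed; no named fact is introduced;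
nothing is booked by this unit (the lane books, the referee rules). Unit `b2b-bsdres-x9`, gen 17.

## What this file does (our own work, hence `Summits/`)

After gen 16 (`HOME/b2b-bsdres-x9/X9-CENSUS-G16.md`, `g16/sweep/FLAGGED-ONLY-40.md`) exactly 40 X9 pairs
`(E, 5)` with `N < 5·10⁵`, `r_an ≤ 1` had no flag-free route of record: their only lane route is the
Jetchev–Cha index bound at the non-surjective prime `5` (flag `JET@nonsurj@5`). One of them, `4418c1`
(`N = 4418 = 2·47² < 5000`, analytic rank `1`, `5S4` image), is covered VERBATIM by the published theorem
Miller, LMS J. Comput. Math. 14 (2011), Thm. 1.2 (irreducible case; tree fact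
`bsdp_of_irreducible_of_conductor_lt`, with the Lawson–Wuthrich 2016 §5 correction recorded in its docstring):
"`r_an(E) ≤ 1`, `N_E < 5000`, `E[p]` irreducible ⟹ `BSD(E,p)`". This file is the per-pair KERNEL RECORD
`bsdp_4418c1`: the only binders are that PUBLISHED fact (`hMiller`, the same binder referee A admitted for the
partner `4232d1` of `88872n1` in `X9/TransportSweepH.lean`, R203.4) and two FINITE certificates of record —
`r_an(E) ≤ 1` (Cremona: rank `1`) and `N_E < 5000` (Cremona: `N = 4418`); the irreducibility of `E[5]` is
DECIDED IN THE KERNEL from the integer model by a Frobenius witness (`ℓ = 3`: `#Ẽ(𝔽₃) = 4`, `a₃ = 0`,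
`X² + 3` has no root mod `5`; Mazur 1978 Prop. 6.3 (1) as in `IntModel`), as are `Δ ≠ 0` and global
minimality (Kraus' bounded criterion). No transport, no certificate of this unit, no `native_decide`.

References: R. L. Miller, LMS J. Comput. Math. 14 (2011) Thm. 1.2, Def. 1.1 [Miller2011LMS]; T. Lawson,
C. Wuthrich, Springer PROMS 188 (2016) §5 [LawsonWuthrich2016]; B. Mazur, IHÉS 47 (1978) Prop. 6.3 (1)
[Mazur1978]; J. H. Silverman, AEC VII.1 [SilvermanAEC2009]; Cremona's tables (label `4418c1`).
-/

set_option autoImplicit false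

noncomputable section

open scoped Classical MatrixGroups ModularForm

open CongruenceSubgroup WeierstrassCurve Literature.NumberTheory.EllipticCurves
  Literature.NumberTheory.EllipticCurves.ModularForms Literature.NumberTheory.EllipticCurves.Rank1Residual
  Literature.NumberTheory.EllipticCurves.Rank1Residual.Typed
  Literature.NumberTheory.EllipticCurves.Rank1Residual.X11RankOneCertificates
  Summit.BirchSwinnertonDyer.BirchSwinnertonDyer.Rank1Residual.IntModel
  Summit.BirchSwinnertonDyer.BirchSwinnertonDyer.Rank1Residual.X11RankOne
  Summit.BirchSwinnertonDyer.Rank1Residual.X11b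

namespace Summit.BirchSwinnertonDyer.Rank1Residual.X9

/-! ### §1. Kernel-decided data of Cremona's model `4418c1 = [1, -1, 1, -109, 469]` -/

/-- `#Ẽ(𝔽₃) = 4` (`a₃ = 0`; `X² − 0·X + 3` root-free mod `5`: the Frobenius witness for the irreducibility of
`E[5]`) for Cremona's model `4418c1` (kernel count). [folklore] -/
theorem card_4418c1_3 :
    Nat.card (((⟨1, -1, 1, -109, 469⟩ : WeierstrassCurve ℤ).map
      (Int.castRingHom (ZMod 3))).toAffine.Point) = 4 := by
  rw [@WeierstrassCurve.natCard_point_eq_one_add_card (ZMod 3) (@ZMod.instField 3 ⟨by norm_num⟩) _ _ _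
    (by decide +kernel), @card_sol_eq_sum_euler (ZMod 3) (@ZMod.instField 3 ⟨by norm_num⟩) _ _
    (by rw [ZMod.ringChar_zmod_n]; decide), ZMod.card]
  decide +kernel

/-- `4418c1`'s Cremona model is an elliptic curve (`Δ = −2¹⁰·47² ≠ 0`, kernel). [cite: Cremona2006, Table 1 (Cremona label 4418c1)] -/
theorem isElliptic_4418c1 : (⟨1, -1, 1, -109, 469⟩ : WeierstrassCurve ℚ).IsElliptic :=
  isElliptic_of_discOf_ne_zero 1 (-1) 1 (-109) 469 (by decide +kernel)

/-- `4418c1`'s Cremona model is globally minimal (Kraus' bounded criterion, kernel). [cite: SilvermanAEC2009, VII.1 Remark 1.1] -/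
theorem isGloballyMinimal_4418c1 : (⟨1, -1, 1, -109, 469⟩ : WeierstrassCurve ℚ).IsGloballyMinimal :=
  isGloballyMinimal_of_krausCriterion_bounded₂ 1 (-1) 1 (-109) 469 (by decide +kernel) (by decide +kernel)
    (by decide +kernel)

/-! ### §2. The record -/

/-- **`BSD(E,5)` for `4418c1`** (`N = 4418 = 2·47² < 5000`; good ORDINARY at `5`, `a₅ = −3`; Cremona model
`[1, -1, 1, -109, 469]`; `ρ̄_{E,5}` irreducible (Frobenius witness `ℓ = 3`: `#Ẽ(𝔽₃) = 4`, `a₃ = 0`) and — census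
datum — of EXCEPTIONAL type `5S4`; analytic rank `1`; `#Ш_an = 1`; `∏c_ℓ = 10` (Tamagawa-obstructed Heegner index:
x9 fold `JETCHEV-CHA` `D = −23`, `m = 20`, `ord₅ m = 1`; lane route of record T-JET only, flag `JET@nonsurj@5`)) —
**directly from Miller 2011 Thm. 1.2** (`hMiller` = `bsdp_of_irreducible_of_conductor_lt`: `r_an ≤ 1`, `N < 5000`,
`E[5]` irreducible ⟹ `BSD(E,5)`), with the FINITE certificates `r_an(E) ≤ 1` (`hran`) and `N_E < 5000` (`hN`) as
displayed binders and the irreducibility DECIDED in the kernel (Mazur 1978 Prop. 6.3 (1) with the witness above).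
Per pair; X9 stays typed; nothing booked here. [cite: Miller2011LMS, Thm. 1.2 and Def. 1.1]
[cite: Mazur1978, §6 Prop. 6.3 (1) (p. 153)] -/
theorem bsdp_4418c1 (hMiller : bsdp_of_irreducible_of_conductor_lt)
    (W : WeierstrassCurve ℚ) [W.IsElliptic] [W.IsGloballyMinimal] [Fact (Nat.Prime 5)]
    (hW : W = ⟨1, -1, 1, -109, 469⟩) (hran : W.analyticRank ≤ 1) (hN : W.conductorNorm ℤ < 5000) :
    BSDp W 5 := by
  have hIW : integralModelInt W = ⟨1, -1, 1, -109, 469⟩ :=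
    integralModelInt_eq_of_map_eq _ (by rw [hW]; ext <;> simp [WeierstrassCurve.map])
  haveI : Fact (Nat.Prime 3) := ⟨by norm_num⟩
  have hΔ : (⟨1, -1, 1, -109, 469⟩ : WeierstrassCurve ℤ).Δ = discOf [1, -1, 1, -109, 469] :=
    intCurve_Δ 1 (-1) 1 (-109) 469
  have hirr : W.HasIrreducibleModPGaloisRep 5 := by
    refine hasIrreducibleModPGaloisRep_of_intModel_of_noroot hIW 5 3 (by norm_num)
      (by rw [hΔ]; decide +kernel) card_4418c1_3
      (forall_zmod_of_forall_lt fun t ht h0 ↦ ?_)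
    have hnoroot : ∀ t : ℕ, t < 5 → ¬ (5 : ℤ) ∣ (t : ℤ) ^ 2 - ((3 : ℤ) + 1 - (4 : ℕ)) * t + 3 := by decide
    refine hnoroot t ht ?_
    have h5 : ((5 : ℕ) : ℤ) ∣ (t : ℤ) ^ 2 - ((3 : ℤ) + 1 - (4 : ℕ)) * t + 3 := by
      rw [← ZMod.intCast_zmod_eq_zero_iff_dvd]
      push_cast at h0 ⊢
      linear_combination h0
    exact_mod_cast h5
  exact hMiller W hran hN 5 Fact.out hirr

end Summit.BirchSwinnertonDyer.Rank1Residual.X9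

end
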